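import Mathlib.Analysis.SpecialFunctions.Trigonometric.Inverse
import Literature.MathematicalPhysics.QuantumManyBody.PeriodicBoseGasTagged
import Literature.MathematicalPhysics.QuantumManyBody.PeriodicBoseGasThm31
import HarnessLib

/-!
# The impurity coupling path on the torus: coupled tagged energies, the Fubini–Study angle of
tagged states, and the insertion state `φ₀ ⊗ Θ`

Topic `Literature/MathematicalPhysics/QuantumManyBody` (companion of `PeriodicBoseGasTagged.lean`;
wanted by route BECInsertionCorrector, crux `CorrectorClosure` stmt-AtomisticToContinuum-12058, line
`llp-fidelity-arc`, whose registered stubs are stated over these objects). Definitions and their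
definitional API only — no statement about ground states is made here.

* `couplingHeight λ = λ/(1-λ) ∈ [0, ∞]` and the **ceiling coupling path**
  `couplingProfile v λ = min(v, λ/(1-λ))` (`u₀ = 0`, `u₁ = v` because `1/0 = ⊤` in `ℝ≥0∞`;
  `λ ↦ u_λ` monotone and continuous also for hard cores, where the scaled path `λ • v` would jump
  at `0⁺`). Switching the impurity–bath coupling on along a path `λ ↦ H_λ` is the setting of the
  quasiparticle-residue / orthogonality-catastrophe analysis of a mobile impurity
  [GuentherEtAl2021, eqs. (3)–(4), (10)].
* `coupledEnergy v λ Ψ` — the **coupled tagged energy** on the torus of side `L` (lab frame, over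
  `TaggedPeriodicTrialState N L`): particle `0` is the impurity with kinetic weight `1`, the bath
  `1, …, N` interacts through `v^per`, and the impurity–bath interaction is `∑_{j ≥ 1} u_λ^per(xⱼ - x₀)`;
  the quadratic form of `H_λ = -Δ₀ - ∑ⱼ Δⱼ + ∑ⱼ u_λ^per(xⱼ - x₀) + ∑_{i<j} v^per(xᵢ - xⱼ)`, i.e.
  [GuentherEtAl2021, eq. (4)] with impurity–boson coupling `U = u_λ` different from the boson–boson
  one and equal masses (the tree's `taggedPeriodicEnergy` is the case `U = v` with a mass dial). At
  `λ = 1` it IS `taggedPeriodicEnergy v 1` (`coupledEnergy_one`), hence the periodic `(N+1)`-body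
  energy on Bose-symmetric states (`coupledEnergy_one_toTagged`); `coupledGroundStateEnergy` is its
  infimum, monotone in `λ` and below `periodicGroundStateEnergy v (N+1) L`
  (`coupledGroundStateEnergy_le_periodic`).
* `taggedInner Ψ Φ = ∫_{cell^{N+1}} conj Ψ · Φ` and the **Fubini–Study angle**
  `fsAngle Ψ Φ = arccos |⟨Ψ, Φ⟩| ∈ [0, π/2]` between the rays of two tagged states — the distance in
  which a ground-state fidelity `|⟨Ψ₀(λ), Ψ₀(λ')⟩|` is `cos d` [Gu2010, §2 (fidelity and fidelity
  susceptibility)].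
* `insertionState hL Θ = φ₀ ⊗ Θ : (x₀, Y) ↦ L^{-3/2} Θ(Y)` — one zero-momentum particle added to the
  bath state `Θ` (`TaggedPeriodicTrialState.product` with the constant one-body factor): the
  decoupled ground state when `Θ` is the bath ground state; `|⟨φ₀ ⊗ Θ, Ψ⟩|²` is the insertion
  (quasiparticle) residue at zero momentum [GuentherEtAl2021, eq. (3)].

## Design choices

* `ℝ≥0∞`-valued energies and the cell `[0,L)^{3(N+1)}` exactly as in `PeriodicBoseGas*.lean`;
  everything is empty/`⊤` for `L ≤ 0` (`coupledGroundStateEnergy_of_nonpos`).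
* The path RAISES A CEILING rather than scaling `λ • v`, so that `⊤`-valued (hard-core) profiles,
  admitted by `IsRepulsiveFiniteRange`, give a family increasing continuously to `v`.
* Deliberately NOT here: near-minimiser / metric-speed predicates of the route (they are inlined in
  its statements), and any ground-state existence or fidelity claim.
* Mathlib has no Fubini–Study metric on an `L²` projective space in this concrete form (searched
  `fubiniStudy`, `arccos.*inner`); `Real.arccos`, set integrals and `TaggedPeriodicTrialState` are
  reused.

## References

* [GuentherEtAl2021] N.-E. Guenther, R. Schmidt, G. M. Bruun, V. Gurarie, P. Massignan, *Mobile
  impurity in a Bose–Einstein condensate and the orthogonality catastrophe*, Phys. Rev. A 103 (2021)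
  013317: eqs. (3), (4), (10).
* [Gu2010] S.-J. Gu, *Fidelity approach to quantum phase transitions*, Int. J. Mod. Phys. B 24 (2010)
  4371: §2.
* [Fournais2020] S. Fournais, *Length scales for BEC in the dilute Bose gas*, (1.1)–(1.2) (periodic
  setting).
-/

noncomputable section

open MeasureTheory Filter
open scoped ENNReal NNReal ComplexConjugate

namespace Literature.MathematicalPhysics.QuantumManyBody.BoseGas

variable {N : ℕ} {L : ℝ}

/-! ## The coupling path (ceiling parametrisation) -/

/-- The coupling ceiling `h(λ) = λ/(1-λ) ∈ [0, ∞]` (`ENNReal` division: `h(λ) = 0` for `λ ≤ 0`,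
`h(1) = 1/0 = ⊤`, and `h(λ) = ⊤` for `λ ≥ 1`). [folklore] -/
def couplingHeight (lam : ℝ) : ℝ≥0∞ :=
  ENNReal.ofReal lam / ENNReal.ofReal (1 - lam)

/-- The impurity–bath pair profile at coupling `λ`: the pair potential `v` clipped at the ceiling
`h(λ)`, `u_λ(r) = min(v(r), h(λ))` — so `u₀ = 0`, `u₁ = v` (hard cores included), `u_λ ≤ v`, and
`λ ↦ u_λ` is monotone. [folklore] -/
def couplingProfile (v : ℝ → ℝ≥0∞) (lam : ℝ) (r : ℝ) : ℝ≥0∞ :=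
  min (v r) (couplingHeight lam)

/-- `h(0) = 0`. [folklore] -/
@[simp]
theorem couplingHeight_zero : couplingHeight 0 = 0 := by
  simp [couplingHeight]

/-- `h(1) = ⊤`. [folklore] -/
@[simp]
theorem couplingHeight_one : couplingHeight 1 = ⊤ := by
  rw [couplingHeight, sub_self, ENNReal.ofReal_zero, ENNReal.ofReal_one,
    ENNReal.div_zero one_ne_zero]

/-- `h` is monotone. [folklore] -/
theorem couplingHeight_mono {a b : ℝ} (h : a ≤ b) : couplingHeight a ≤ couplingHeight b :=
  ENNReal.div_le_div (ENNReal.ofReal_le_ofReal h) (ENNReal.ofReal_le_ofReal (by linarith))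

/-- `u₀ = 0`: the path starts at the decoupled Hamiltonian. [folklore] -/
@[simp]
theorem couplingProfile_zero (v : ℝ → ℝ≥0∞) : couplingProfile v 0 = 0 := by
  funext r
  show min (v r) (couplingHeight 0) = 0
  rw [couplingHeight_zero]
  exact min_eq_right zero_le

/-- `u₁ = v`: the path ends at the fully coupled `(N+1)`-body Hamiltonian. [folklore] -/
@[simp]
theorem couplingProfile_one (v : ℝ → ℝ≥0∞) : couplingProfile v 1 = v := by
  funext r
  show min (v r) (couplingHeight 1) = v r
  rw [couplingHeight_one]
  exact min_top_right _

/-- The profile is monotone in the coupling. [folklore] -/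
theorem couplingProfile_mono (v : ℝ → ℝ≥0∞) {a b : ℝ} (h : a ≤ b) (r : ℝ) :
    couplingProfile v a r ≤ couplingProfile v b r :=
  min_le_min le_rfl (couplingHeight_mono h)

/-- The profile never exceeds the pair potential: `u_λ ≤ v`. [folklore] -/
theorem couplingProfile_le (v : ℝ → ℝ≥0∞) (lam : ℝ) (r : ℝ) : couplingProfile v lam r ≤ v r :=
  min_le_left _ _

/-- A measurable profile has measurable clipped profiles. [folklore] -/
theorem measurable_couplingProfile {v : ℝ → ℝ≥0∞} (hv : Measurable v) (lam : ℝ) :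
    Measurable (couplingProfile v lam) :=
  hv.min measurable_const

/-- A finite-range profile has finite-range clipped profiles (same range). [folklore] -/
theorem isRepulsiveFiniteRange_couplingProfile {v : ℝ → ℝ≥0∞} (hv : IsRepulsiveFiniteRange v)
    (lam : ℝ) : IsRepulsiveFiniteRange (couplingProfile v lam) := by
  obtain ⟨hmeas, R₀, hR₀⟩ := hv
  refine ⟨hmeas.min measurable_const, R₀, fun r hr => ?_⟩
  show min (v r) (couplingHeight lam) = 0
  rw [hR₀ r hr]
  exact min_eq_left zero_le

/-- The periodised potential is monotone in the profile. [folklore] -/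
theorem periodizedPotential_mono' {v w : ℝ → ℝ≥0∞} (h : ∀ r, v r ≤ w r) (L : ℝ) (x : Space) :
    periodizedPotential v L x ≤ periodizedPotential w L x :=
  ENNReal.tsum_le_tsum fun _ => h _

/-- The pinned-scatterer potential is monotone in the profile. [folklore] -/
theorem impurityInteraction_mono' {v w : ℝ → ℝ≥0∞} (h : ∀ r, v r ≤ w r) (L : ℝ) (x : Space)
    {M : ℕ} (Y : Config M) : impurityInteraction v L x Y ≤ impurityInteraction w L x Y :=
  Finset.sum_le_sum fun _ _ => periodizedPotential_mono' h L _

/-! ## The coupled tagged energy (lab frame) -/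

/-- **Coupled tagged energy** at coupling `λ` on the torus of side `L`: particle `0` is the inserted
boson (kinetic weight `1`), the bath `1, …, N` interacts through `v^per`, and the impurity–bath
interaction is `∑_{j≥1} u_λ^per(xⱼ - x₀)` with `u_λ = couplingProfile v λ`:
`⟨Ψ, H_λ Ψ⟩ = ∫_{[0,L)^{3(N+1)}} |∇Ψ|² + (∑ⱼ u_λ^per(xⱼ-x₀) + ∑_{1≤i<j} v^per(xᵢ-xⱼ)) |Ψ|²`. At
`λ = 1` this is the `(N+1)`-body form `taggedPeriodicEnergy v 1` (`coupledEnergy_one`); at `λ = 0` the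
impurity is free.
[cite: GuentherEtAl2021, eq. (4) (impurity–boson coupling U = u_λ, equal masses; periodic setting of Fournais2020 (1.1))] -/
def coupledEnergy (v : ℝ → ℝ≥0∞) (lam : ℝ) (Ψ : TaggedPeriodicTrialState N L) : ℝ≥0∞ :=
  ∫⁻ X in cellN (N + 1) L, taggedKineticDensity 1 Ψ.ψ X +
    (impurityInteraction (couplingProfile v lam) L (X 0) (Matrix.vecTail X) +
      periodicInteraction v L (Matrix.vecTail X)) * (‖Ψ.ψ X‖₊ : ℝ≥0∞) ^ 2

/-- The coupled ground-state energy `E_λ(N, L) = inf_Ψ ⟨Ψ, H_λ Ψ⟩` over tagged trial states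
(`⊤` for `L ≤ 0`, where there are none). [cite: GuentherEtAl2021, eq. (4) (with Fournais2020 (1.2))] -/
def coupledGroundStateEnergy (v : ℝ → ℝ≥0∞) (lam : ℝ) (N : ℕ) (L : ℝ) : ℝ≥0∞ :=
  ⨅ Ψ : TaggedPeriodicTrialState N L, coupledEnergy v lam Ψ

/-- Variational principle for the coupled problem. [folklore] -/
theorem coupledGroundStateEnergy_le (v : ℝ → ℝ≥0∞) (lam : ℝ) (Ψ : TaggedPeriodicTrialState N L) :
    coupledGroundStateEnergy v lam N L ≤ coupledEnergy v lam Ψ :=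
  iInf_le _ Ψ

/-- At full coupling the coupled energy is the `(N+1)`-body form on tagged states. [folklore] -/
theorem coupledEnergy_one (v : ℝ → ℝ≥0∞) (Ψ : TaggedPeriodicTrialState N L) :
    coupledEnergy v 1 Ψ = taggedPeriodicEnergy v 1 Ψ := by
  rw [coupledEnergy, couplingProfile_one]
  rfl

/-- At full coupling a Bose-symmetric state has its periodic `(N+1)`-body energy. [folklore] -/
theorem coupledEnergy_one_toTagged (v : ℝ → ℝ≥0∞) (Φ : PeriodicTrialState (N + 1) L) :
    coupledEnergy v 1 Φ.toTagged = periodicEnergy v Φ := by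
  rw [coupledEnergy_one, taggedPeriodicEnergy_one_toTagged]

/-- `E₁(N, L)` is the tagged (`κ = 1`) ground-state energy of the tree. [folklore] -/
theorem coupledGroundStateEnergy_one (v : ℝ → ℝ≥0∞) (N : ℕ) (L : ℝ) :
    coupledGroundStateEnergy v 1 N L = taggedPeriodicGroundStateEnergy v 1 N L := by
  unfold coupledGroundStateEnergy taggedPeriodicGroundStateEnergy
  exact iInf_congr fun Ψ => coupledEnergy_one v Ψ

/-- At zero coupling the coupled energy is kinetic energy plus the bath interaction only.
[folklore] -/
theorem coupledEnergy_zero (v : ℝ → ℝ≥0∞) (Ψ : TaggedPeriodicTrialState N L) :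
    coupledEnergy v 0 Ψ = ∫⁻ X in cellN (N + 1) L, taggedKineticDensity 1 Ψ.ψ X +
      periodicInteraction v L (Matrix.vecTail X) * (‖Ψ.ψ X‖₊ : ℝ≥0∞) ^ 2 := by
  rw [coupledEnergy, couplingProfile_zero]
  simp only [impurityInteraction_zero, zero_add]

/-- The coupled energy is monotone in the coupling. [folklore] -/
theorem coupledEnergy_mono (v : ℝ → ℝ≥0∞) {a b : ℝ} (h : a ≤ b) (Ψ : TaggedPeriodicTrialState N L) :
    coupledEnergy v a Ψ ≤ coupledEnergy v b Ψ := by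
  unfold coupledEnergy
  refine lintegral_mono fun X => ?_
  gcongr
  exact impurityInteraction_mono' (couplingProfile_mono v h) L _ _

/-- The coupled ground-state energy is monotone in the coupling. [folklore] -/
theorem coupledGroundStateEnergy_mono (v : ℝ → ℝ≥0∞) {a b : ℝ} (h : a ≤ b) (N : ℕ) (L : ℝ) :
    coupledGroundStateEnergy v a N L ≤ coupledGroundStateEnergy v b N L :=
  iInf_mono fun Ψ => coupledEnergy_mono v h Ψ

/-- The coupled energy is dominated by the fully coupled one: `⟨Ψ, H_λ Ψ⟩ ≤ ⟨Ψ, H₁ Ψ⟩` for every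
`λ` (because `u_λ ≤ v`). [folklore] -/
theorem coupledEnergy_le_one (v : ℝ → ℝ≥0∞) (lam : ℝ) (Ψ : TaggedPeriodicTrialState N L) :
    coupledEnergy v lam Ψ ≤ coupledEnergy v 1 Ψ := by
  unfold coupledEnergy
  refine lintegral_mono fun X => ?_
  rw [couplingProfile_one]
  gcongr
  exact impurityInteraction_mono' (couplingProfile_le v lam) L _ _

/-- **The coupled family sits below the `(N+1)`-body problem**: `E_λ(N, L) ≤ E₀^per(N+1, L)` for
every `λ` (`u_λ ≤ v` + symmetric states are tagged states). [folklore] -/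
theorem coupledGroundStateEnergy_le_periodic (v : ℝ → ℝ≥0∞) (lam : ℝ) (N : ℕ) (L : ℝ) :
    coupledGroundStateEnergy v lam N L ≤ periodicGroundStateEnergy v (N + 1) L :=
  (iInf_mono fun Ψ => coupledEnergy_le_one v lam Ψ).trans
    ((coupledGroundStateEnergy_one v N L).trans_le (taggedPeriodicGroundStateEnergy_one_le v N L))

/-- For `L ≤ 0` there are no tagged states and every coupled ground-state energy is `⊤`.
[folklore] -/
theorem coupledGroundStateEnergy_of_nonpos (v : ℝ → ℝ≥0∞) (lam : ℝ) (N : ℕ) (hL : L ≤ 0) :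
    coupledGroundStateEnergy v lam N L = ⊤ := by
  haveI := TaggedPeriodicTrialState.isEmpty_of_nonpos (N := N) hL
  exact iInf_of_empty _

/-! ## Fubini–Study geometry of tagged states -/

/-- The cell inner product `⟨Ψ, Φ⟩ = ∫_{[0,L)^{3(N+1)}} conj Ψ · Φ` of two tagged states. [folklore] -/
def taggedInner (Ψ Φ : TaggedPeriodicTrialState N L) : ℂ :=
  ∫ X in cellN (N + 1) L, conj (Ψ.ψ X) * Φ.ψ X

/-- The **Fubini–Study angle** `d(Ψ, Φ) = arccos |⟨Ψ, Φ⟩| ∈ [0, π/2]` between the rays of two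
normalised tagged states (a metric on rays: phases are invisible).
[cite: Gu2010, §2 (ground-state fidelity; Fubini–Study distance of rays)] -/
def fsAngle (Ψ Φ : TaggedPeriodicTrialState N L) : ℝ :=
  Real.arccos ‖taggedInner Ψ Φ‖

/-- `0 ≤ d(Ψ, Φ)`. [folklore] -/
theorem fsAngle_nonneg (Ψ Φ : TaggedPeriodicTrialState N L) : 0 ≤ fsAngle Ψ Φ :=
  Real.arccos_nonneg _

/-- `d(Ψ, Φ) ≤ π/2` (the argument of `arccos` is a norm, hence nonnegative). [folklore] -/
theorem fsAngle_le_pi_div_two (Ψ Φ : TaggedPeriodicTrialState N L) : fsAngle Ψ Φ ≤ Real.pi / 2 :=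
  Real.arccos_le_pi_div_two.2 (norm_nonneg _)

/-! ## The insertion state `φ₀ ⊗ Θ` -/

/-- The constant one-body mode `L^{-3/2}` is normalised on the cell. [folklore] -/
theorem lintegral_cell_const_sq (hL : 0 < L) :
    ∫⁻ _ in cell L, ((‖((Real.sqrt (L ^ 3))⁻¹ : ℂ)‖₊ : ℝ≥0∞)) ^ 2 = 1 := by
  rw [setLIntegral_const, volume_cell, nnnorm_constantMode_sq hL,
    ENNReal.inv_mul_cancel (pow_ne_zero _ (ENNReal.ofReal_pos.2 hL).ne')
      (ENNReal.pow_ne_top ENNReal.ofReal_ne_top)]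

/-- **The insertion state** `φ₀ ⊗ Θ : (x₀, Y) ↦ L^{-3/2} Θ(Y)` — one zero-momentum particle added
to the bath state `Θ`; the ground state of the decoupled Hamiltonian `H₀` when `Θ` is the bath
ground state. [folklore] -/
def insertionState (hL : 0 < L) (Θ : PeriodicTrialState N L) : TaggedPeriodicTrialState N L :=
  TaggedPeriodicTrialState.product (fun _ : Space => ((Real.sqrt (L ^ 3))⁻¹ : ℂ)) contDiff_const
    (fun _ _ => rfl) (lintegral_cell_const_sq hL) Θ

/-- The wave function of the insertion state: `(φ₀ ⊗ Θ)(X) = L^{-3/2} Θ(X 1, …, X N)`. [folklore] -/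
@[simp]
theorem insertionState_ψ (hL : 0 < L) (Θ : PeriodicTrialState N L) (X : Config (N + 1)) :
    (insertionState hL Θ).ψ X = ((Real.sqrt (L ^ 3))⁻¹ : ℂ) * Θ.ψ (Matrix.vecTail X) := by
  rfl

end Literature.MathematicalPhysics.QuantumManyBody.BoseGas

end
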